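import Summits.PneNP.PneNP.Theorems.ExpanderLinearGeneratorsResolutionNFreeColumnLLLLaw
import Summits.PneNP.PneNP.Theorems.ExpanderLinearGeneratorsResolutionNFreeLight
import HarnessLib

/-!
# The n-free resolution-size rung for expanding linear systems, XVIII: the light-expansion law and the 11443 rung, local-lemma form

Support file for cruxes `stmt-PneNP-11442` (`ExpansionForcesDepthFregeSize`, the expansion-scale
law) and `stmt-PneNP-11443` (`LinearGeneratorDepthFregeHard`, Krajíček's Problem 19.4.5 in
universal-expander form, scale `r = n^{1-δ}`). Files XIII–XIV proved the n-free EXPONENTIAL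
resolution law whenever the LIGHT variables — those of column weight `≤ Δ` — carry the
`(r, 3ℓ/4)`-boundary expansion, heavy variables being arbitrary, with the threshold of Theorem C:
`Δ ≤ r^{(1-ε)ℓ/2-1}/2^ℓ`, hence the resolution rung of crux 11443 for every `δ < 1` up to column
weight `n^{a(1-δ)}`, `a < ℓ/2 - 1`. With Theorem C′ (file XVII, Lovász Local Lemma instead of the
union bound) the same reduction — substitute `0` for the heavy variables
(`exists_isResRefutation_zero`) — gives the light threshold `Δ ≤ r^{(1-ε)(⌈3ℓ/4⌉-1)}/((ℓ+1)2^{ℓ+4})`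
and the exponent range `a < ⌈3ℓ/4⌉ - 1`:

* `resolution_size_nfree_light_lll` — the light-expansion law, local-lemma threshold;
* `resolution_size_light_pow_lll` — crux-shaped: light = column weight `≤ r^a`, `a < ⌈3ℓ/4⌉ - 1`;
* `resolution_size_light_rpow_lll`, `resolution_size_rpow_of_colWeight_lll` — the resolution
  rung of crux 11443 for every `δ < 1` at (light) column weight `≤ n^{a(1-δ)}`, `a < ⌈3ℓ/4⌉ - 1`.

At `ℓ = 9` and `m ≤ n²` (Krajíček's regime) this covers every `δ < 2/3` (files XIII–XIV:
`δ < 3/7`, below the size–width rung `δ < 1/2`). What remains open at the resolution rung is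
expansion carried by variables of column weight `n^{(⌈3ℓ/4⌉-1-o(1))(1-δ)}` and more.

References: E. Ben-Sasson, A. Wigderson, J. ACM 48 (2001), §2.2, Thm. 6.5; P. Erdős, L. Lovász
(1975); N. Alon, J. Spencer, *The Probabilistic Method*, Ch. 5; J. Krajíček, *Proof complexity*
(CUP 2019), §13.4, Cor. 13.4.6, Problem 19.4.5.
-/

namespace Summit.PneNP.PneNP.Theorems.ResNFree

set_option linter.dupNamespace false -- `Summit.PneNP.PneNP.…`: summit = sub-problem (D-0017)

open Finset Filter Topology Literature.Computability.Complexity Literature.Computability.MetaComplexity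

variable {m n : ℕ}

/-- **The n-free EXPONENTIAL resolution-size law when the light variables carry the expansion,
local-lemma threshold.** For every locality `ℓ ≥ 1` and `0 < ε < 1`, all real `r ≥ 2`, all
`n, m, Δ` and every `ℓ`-sparse `E : Fin m → LinEqMod 2 n`: if the LIGHT PARTS of the row
supports — the variables of the support lying in at most `Δ` rows — form an
`(r, 3ℓ/4)`-boundary expander and `Δ ≤ r^{(1-ε)(⌈3ℓ/4⌉-1)}/((ℓ+1) 2^{ℓ+4})`, then every
resolution refutation of `sumEncoding 1 E` has at least `2^{r^ε/112 - 2}` lines — independently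
of `n`, of `m`, and of the heavy variables. Proof: substitute `0` for the heavy variables and
apply Theorem C′ to the zeroed system.
[Ben-Sasson–Wigderson 2001, §2.2, Thm. 6.5; Erdős–Lovász 1975; Krajíček 2019, §13.4] [folklore] -/
theorem resolution_size_nfree_light_lll (ℓ : ℕ) (hℓ : 1 ≤ ℓ) (ε : ℝ) (hε : 0 < ε) (hε1 : ε < 1)
    (r : ℝ) (hr : 2 ≤ r) (n m Δ : ℕ) (E : Fin m → LinEqMod 2 n)
    (hsparse : ∀ i, (E i).supp.card ≤ ℓ)
    (hexp : IsBoundaryExpander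
      (fun i => ((E i).supp.filter fun j =>
        ((univ : Finset (Fin m)).filter fun i' => j ∈ (E i').supp).card ≤ Δ).map Fin.valEmbedding)
      r (3 / 4 * ℓ))
    (hΔ : (Δ : ℝ) ≤ r ^ ((1 - ε) * ((⌈(3 : ℝ) / 4 * ℓ⌉₊ - 1 : ℕ) : ℝ))
      / (((ℓ : ℝ) + 1) * 2 ^ (ℓ + 4)))
    (π : List (ResLine ℕ)) (hπ : IsResRefutation (sumEncoding 1 E) π) :
    (2 : ℝ) ^ (r ^ ε / 112 - 2) ≤ (π.length : ℝ) := by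
  classical
  -- the light variables and the zeroed system
  set L : Finset (Fin n) := univ.filter fun j =>
    ((univ : Finset (Fin m)).filter fun i' => j ∈ (E i').supp).card ≤ Δ with hL
  set E' : Fin m → LinEqMod 2 n := fun i => (fun j => if j ∈ L then (E i).1 j else 0, (E i).2)
    with hE'def
  have hE' : ∀ i j, (E' i).1 j = if j ∈ L then (E i).1 j else 0 := fun i j => rfl
  have hb : ∀ i, (E' i).2 = (E i).2 := fun i => rfl
  have hsupp : ∀ i, (E' i).supp = (E i).supp.filter fun j =>
      ((univ : Finset (Fin m)).filter fun i' => j ∈ (E i').supp).card ≤ Δ := by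
    intro i
    rw [LinGen.supp_restrict hE' i]
    exact Finset.filter_congr fun j _ => by simp [hL]
  have hsparse' : ∀ i, (E' i).supp.card ≤ ℓ := fun i => by
    rw [hsupp i]; exact (Finset.card_filter_le _ _).trans (hsparse i)
  have hexp' : IsBoundaryExpander (fun i => (E' i).supp.map Fin.valEmbedding) r (3 / 4 * ℓ) := by
    have : (fun i => (E' i).supp.map Fin.valEmbedding) = fun i => ((E i).supp.filter fun j =>
        ((univ : Finset (Fin m)).filter fun i' => j ∈ (E i').supp).card ≤ Δ).map Fin.valEmbedding :=
      funext fun i => by rw [hsupp i]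
    rw [this]
    exact hexp
  have hcol' : ∀ j : Fin n, ((univ : Finset (Fin m)).filter fun i => j ∈ (E' i).supp).card ≤ Δ := by
    intro j
    by_cases hj : ((univ : Finset (Fin m)).filter fun i' => j ∈ (E i').supp).card ≤ Δ
    · refine le_trans (Finset.card_le_card ?_) hj
      intro i hi
      simp only [Finset.mem_filter, Finset.mem_univ, true_and] at hi ⊢
      rw [hsupp i, Finset.mem_filter] at hi
      exact hi.1
    · have h0 : ((univ : Finset (Fin m)).filter fun i => j ∈ (E' i).supp) = ∅ := by
        refine Finset.filter_eq_empty_iff.2 fun i _ hi => ?_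
        rw [hsupp i, Finset.mem_filter] at hi
        exact hj hi.2
      rw [h0, Finset.card_empty]
      exact Nat.zero_le _
  -- nonempty zeroed supports (light expansion of single rows), and the transferred refutation
  have hℓpos : (0 : ℝ) < 3 / 4 * ℓ := mul_pos (by norm_num) (Nat.cast_pos.2 hℓ)
  have hne : ∀ i, (E' i).supp.Nonempty := fun i => by
    have h := hexp'.card_pos hℓpos (by linarith) i
    rw [Finset.card_map] at h
    exact Finset.card_pos.1 h
  obtain ⟨π', hπ', hlen⟩ := exists_isResRefutation_zero hE' hb hne hπ
  have hmain := resolution_size_nfree_column_lll ℓ hℓ ε hε hε1 r hr n m Δ E' hsparse' hexp' hcol'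
    hΔ π' hπ'
  rwa [hlen] at hmain

/-- **The n-free exponential resolution law at polynomial LIGHT column weight, local-lemma range
(crux-shaped form).** For every locality `ℓ ≥ 1` and every exponent `0 ≤ a < ⌈3ℓ/4⌉ - 1` there
are `ε > 0` and `R` such that for all `r ≥ R`, all `n, m` and every `ℓ`-sparse
`E : Fin m → LinEqMod 2 n` whose variables of column weight `≤ r^a` carry the
`(r, 3ℓ/4)`-boundary expansion of the row supports, every resolution refutation of
`sumEncoding 1 E` has at least `2^{r^ε}` lines — uniformly in `n`, `m` and the heavy variables.
[Ben-Sasson–Wigderson 2001, Thm. 6.5; Erdős–Lovász 1975; Krajíček 2019, §13.4, Problem 19.4.5]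
[folklore] -/
theorem resolution_size_light_pow_lll (ℓ : ℕ) (hℓ : 1 ≤ ℓ) (a : ℝ) (ha : 0 ≤ a)
    (hal : a < ((⌈(3 : ℝ) / 4 * ℓ⌉₊ - 1 : ℕ) : ℝ)) :
    ∃ ε : ℝ, 0 < ε ∧ ∃ R : ℝ, ∀ r : ℝ, R ≤ r → ∀ (n m : ℕ) (E : Fin m → LinEqMod 2 n),
      (∀ i, (E i).supp.card ≤ ℓ) →
      IsBoundaryExpander
        (fun i => ((E i).supp.filter fun j =>
          ((((univ : Finset (Fin m)).filter fun i' => j ∈ (E i').supp).card : ℕ) : ℝ) ≤ r ^ a).map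
          Fin.valEmbedding) r (3 / 4 * ℓ) →
      ∀ π : List (ResLine ℕ), IsResRefutation (sumEncoding 1 E) π →
        (2 : ℝ) ^ (r ^ ε) ≤ (π.length : ℝ) := by
  classical
  -- the exponent gap (as in `resolution_size_column_pow_lll`)
  set Lr : ℝ := ((⌈(3 : ℝ) / 4 * ℓ⌉₊ - 1 : ℕ) : ℝ) with hLr
  have hLr0 : 0 < Lr := lt_of_le_of_lt ha hal
  set ε₀ : ℝ := (Lr - a) / (2 * Lr) with hε₀
  have hgap : 0 < Lr - a := by linarith
  have hε₀pos : 0 < ε₀ := by rw [hε₀]; positivity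
  have hε₀lt : ε₀ < 1 := by
    rw [hε₀, div_lt_one (by positivity)]; linarith
  set δ : ℝ := (Lr - a) / 2 with hδ
  have hδpos : 0 < δ := by rw [hδ]; positivity
  have hexpo : (1 - ε₀) * Lr = a + δ := by
    rw [hε₀, hδ]; field_simp; ring
  refine ⟨ε₀ / 2, by positivity, ?_⟩
  have hev1 : ∀ᶠ r : ℝ in atTop, ((ℓ : ℝ) + 1) * 2 ^ (ℓ + 4) ≤ r ^ δ :=
    (tendsto_rpow_atTop hδpos).eventually (eventually_ge_atTop _)
  have hev2 : ∀ᶠ r : ℝ in atTop, (115 : ℝ) ≤ r ^ (ε₀ / 2) :=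
    (tendsto_rpow_atTop (by positivity)).eventually (eventually_ge_atTop _)
  obtain ⟨R, hR⟩ := Filter.eventually_atTop.1 ((hev1.and hev2).and (eventually_ge_atTop (2 : ℝ)))
  refine ⟨R, fun r hr n m E hsparse hexp π hπ => ?_⟩
  obtain ⟨⟨hr1, hr2⟩, hr4⟩ := hR r hr
  have hr0 : 0 < r := by linarith
  -- the light set at threshold `⌊r^a⌋`
  set Δ : ℕ := ⌊r ^ a⌋₊ with hΔdef
  have hiff : ∀ j : Fin n,
      ((((univ : Finset (Fin m)).filter fun i' => j ∈ (E i').supp).card : ℕ) : ℝ) ≤ r ^ a ↔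
        ((univ : Finset (Fin m)).filter fun i' => j ∈ (E i').supp).card ≤ Δ := fun j => by
    rw [hΔdef]; exact (Nat.le_floor_iff (Real.rpow_nonneg hr0.le a)).symm
  have hexpΔ : IsBoundaryExpander
      (fun i => ((E i).supp.filter fun j =>
        ((univ : Finset (Fin m)).filter fun i' => j ∈ (E i').supp).card ≤ Δ).map Fin.valEmbedding)
      r (3 / 4 * ℓ) := by
    have : (fun i => ((E i).supp.filter fun j =>
        ((univ : Finset (Fin m)).filter fun i' => j ∈ (E i').supp).card ≤ Δ).map Fin.valEmbedding) =
        fun i => ((E i).supp.filter fun j =>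
          ((((univ : Finset (Fin m)).filter fun i' => j ∈ (E i').supp).card : ℕ) : ℝ) ≤ r ^ a).map
          Fin.valEmbedding :=
      funext fun i => by rw [Finset.filter_congr fun j _ => (hiff j).symm]
    rw [this]
    exact hexp
  have hΔ : (Δ : ℝ) ≤ r ^ ((1 - ε₀) * Lr) / (((ℓ : ℝ) + 1) * 2 ^ (ℓ + 4)) := by
    rw [hexpo, le_div_iff₀ (by positivity), Real.rpow_add hr0]
    have h1 : (Δ : ℝ) ≤ r ^ a := Nat.floor_le (Real.rpow_nonneg hr0.le a)
    exact mul_le_mul h1 hr1 (by positivity) (Real.rpow_nonneg hr0.le a)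
  have hmain := resolution_size_nfree_light_lll ℓ hℓ ε₀ hε₀pos hε₀lt r hr4 n m Δ E hsparse hexpΔ
    hΔ π hπ
  -- `r^{ε₀/2} ≤ r^{ε₀}/112 - 2`
  have hz : r ^ (ε₀ / 2) ≤ r ^ ε₀ / 112 - 2 := by
    set z : ℝ := r ^ (ε₀ / 2) with hz
    have hzz : r ^ ε₀ = z * z := by
      rw [hz, ← Real.rpow_add hr0]; congr 1; ring
    rw [hzz, le_sub_iff_add_le, le_div_iff₀ (by positivity)]
    have hz1 : (115 : ℝ) ≤ z := hr2
    nlinarith only [hz1]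
  calc (2 : ℝ) ^ (r ^ (ε₀ / 2)) ≤ (2 : ℝ) ^ (r ^ ε₀ / 112 - 2) :=
        Real.rpow_le_rpow_of_exponent_le (by norm_num) hz
    _ ≤ (π.length : ℝ) := hmain

/-- **The resolution rung of `LinearGeneratorDepthFregeHard` at EVERY expansion scale, for
light-expanding systems, local-lemma range.** For every locality `ℓ ≥ 1`, every `δ < 1` and
every exponent `0 ≤ a < ⌈3ℓ/4⌉ - 1` there are `ε > 0` and `N` such that for all `n ≥ N`, all
`m` and every `ℓ`-sparse `E : Fin m → LinEqMod 2 n` whose variables of column weight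
`≤ n^{a(1-δ)}` carry the `(n^{1-δ}, 3ℓ/4)`-boundary expansion of the row supports, every
resolution refutation of `sumEncoding 1 E` has at least `2^{n^ε}` lines.
[Ben-Sasson–Wigderson 2001, Thm. 6.5; Krajíček 2019, Cor. 13.4.6, Problem 19.4.5] [folklore] -/
theorem resolution_size_light_rpow_lll (ℓ : ℕ) (hℓ : 1 ≤ ℓ) (δ : ℝ) (hδ1 : δ < 1)
    (a : ℝ) (ha : 0 ≤ a) (hal : a < ((⌈(3 : ℝ) / 4 * ℓ⌉₊ - 1 : ℕ) : ℝ)) :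
    ∃ ε : ℝ, 0 < ε ∧ ∃ N : ℕ, ∀ n : ℕ, N ≤ n → ∀ (m : ℕ) (E : Fin m → LinEqMod 2 n),
      (∀ i, (E i).supp.card ≤ ℓ) →
      IsBoundaryExpander
        (fun i => ((E i).supp.filter fun j =>
          ((((univ : Finset (Fin m)).filter fun i' => j ∈ (E i').supp).card : ℕ) : ℝ) ≤
            (n : ℝ) ^ (a * (1 - δ))).map Fin.valEmbedding)
        ((n : ℝ) ^ (1 - δ)) (3 / 4 * ℓ) →
      ∀ π : List (ResLine ℕ), IsResRefutation (sumEncoding 1 E) π →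
        (2 : ℝ) ^ ((n : ℝ) ^ ε) ≤ (π.length : ℝ) := by
  obtain ⟨ε, hε, R, hR⟩ := resolution_size_light_pow_lll ℓ hℓ a ha hal
  have h1δ : 0 < 1 - δ := by linarith
  refine ⟨ε * (1 - δ), mul_pos hε h1δ, ?_⟩
  have hev : ∀ᶠ n : ℕ in atTop, R ≤ ((n : ℝ)) ^ (1 - δ) :=
    ((tendsto_rpow_atTop h1δ).comp tendsto_natCast_atTop_atTop).eventually (eventually_ge_atTop R)
  obtain ⟨N, hN⟩ := Filter.eventually_atTop.1 hev
  refine ⟨N, fun n hn m E hsparse hexp π hπ => ?_⟩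
  have hn0 : (0 : ℝ) ≤ n := Nat.cast_nonneg n
  have hra : ((n : ℝ) ^ (1 - δ)) ^ a = (n : ℝ) ^ (a * (1 - δ)) := by
    rw [← Real.rpow_mul hn0]; congr 1; ring
  have hrε : ((n : ℝ) ^ (1 - δ)) ^ ε = (n : ℝ) ^ (ε * (1 - δ)) := by
    rw [← Real.rpow_mul hn0]; congr 1; ring
  have h := hR ((n : ℝ) ^ (1 - δ)) (hN n hn) n m E hsparse (by rw [hra]; exact hexp) π hπ
  rwa [hrε] at h

/-- **The resolution rung of `LinearGeneratorDepthFregeHard` at EVERY scale for systems of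
polynomially bounded column weight, local-lemma range.** For every `ℓ ≥ 1`, `δ < 1` and
`0 ≤ a < ⌈3ℓ/4⌉ - 1` there are `ε > 0` and `N` such that for `n ≥ N`: every `ℓ`-sparse
`E : Fin m → LinEqMod 2 n` whose supports form an `(n^{1-δ}, 3ℓ/4)`-boundary expander (the
crux's own hypothesis) and each of whose variables lies in at most `n^{a(1-δ)}` rows admits no
resolution refutation of `sumEncoding 1 E` with fewer than `2^{n^ε}` lines. With `m ≤ n^C` rows
(column weight `≤ n^C`) this is every `δ < 1 - C/(⌈3ℓ/4⌉ - 1)`; Ben-Sasson–Wigderson's size–width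
rung stops at `δ < 1/2`, the union-bound rung (file XIV) at `a < ℓ/2 - 1`.
[Ben-Sasson–Wigderson 2001, Thm. 6.5; Krajíček 2019, Cor. 13.4.6, Problem 19.4.5] [folklore] -/
theorem resolution_size_rpow_of_colWeight_lll (ℓ : ℕ) (hℓ : 1 ≤ ℓ) (δ : ℝ) (hδ1 : δ < 1)
    (a : ℝ) (ha : 0 ≤ a) (hal : a < ((⌈(3 : ℝ) / 4 * ℓ⌉₊ - 1 : ℕ) : ℝ)) :
    ∃ ε : ℝ, 0 < ε ∧ ∃ N : ℕ, ∀ n : ℕ, N ≤ n → ∀ (m : ℕ) (E : Fin m → LinEqMod 2 n),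
      (∀ i, (E i).supp.card ≤ ℓ) →
      IsBoundaryExpander (fun i => (E i).supp.map Fin.valEmbedding) ((n : ℝ) ^ (1 - δ)) (3 / 4 * ℓ) →
      (∀ j : Fin n, ((((univ : Finset (Fin m)).filter fun i' => j ∈ (E i').supp).card : ℕ) : ℝ) ≤
        (n : ℝ) ^ (a * (1 - δ))) →
      ∀ π : List (ResLine ℕ), IsResRefutation (sumEncoding 1 E) π →
        (2 : ℝ) ^ ((n : ℝ) ^ ε) ≤ (π.length : ℝ) := by
  obtain ⟨ε, hε, N, hN⟩ := resolution_size_light_rpow_lll ℓ hℓ δ hδ1 a ha hal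
  refine ⟨ε, hε, N, fun n hn m E hsparse hexp hcol π hπ => hN n hn m E hsparse ?_ π hπ⟩
  have : (fun i => ((E i).supp.filter fun j =>
      ((((univ : Finset (Fin m)).filter fun i' => j ∈ (E i').supp).card : ℕ) : ℝ) ≤
        (n : ℝ) ^ (a * (1 - δ))).map Fin.valEmbedding) = fun i => (E i).supp.map Fin.valEmbedding :=
    funext fun i => by rw [Finset.filter_true_of_mem fun j _ => hcol j]
  rw [this]
  exact hexp

end Summit.PneNP.PneNP.Theorems.ResNFree
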